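import Mathlib
import HarnessLib.Audit
import Summits.PneNP.PneNP.Theorems.PstarHalfChordSystem
import Summits.PneNP.PneNP.Theorems.PstarHalfChordBridgeTools
import Summits.PneNP.PneNP.Theorems.PstarChordBridge
import Summits.PneNP.PneNP.Theorems.PstarNorCoreTools

/-!
# The half-chord bridge: a terminal core WITHOUT Assumption A is a half-chord system (ROUND-24, memo §7 G1 / §11 (N3), O1; `TerminalPeelable`)

FRONTIER range-avoidance ladder, rung F-N3, ROUND 24 (cell `pnp-ideate`, planner memo `r24/CORE-BOUND-NOTES.md` §7 G1, §11 (N3), prover-2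
`O1-SCOPING.md` §3–§5 (S-O1b); typed target `PstarCoreBoundTargets.TerminalPeelable` (p646951); restricted-model proof complexity — nothing here
bears on `P` versus `NP`).

S-O1b, INSTANCE LAYER.  `PstarChordBridge` needs every co-edge of the forest `F = J₀ ∖ N` to be a CHORD (both AND variables private: Assumption A).
Here the co-edges may be HALF-CHORDS: the AND variable in slot `2` is private (`HWF.hp2`), the one in slot `3` is private (chord) or an arbitrary
variable of the base (half-chord; typically shared with another output — the centre-cycle situation of memo §7 G1).  From the same
`PstarChordBridge.BridgeData` with the weaker well-formedness `HWF` we build `hsys I B : HalfChordSystem` (`PstarHalfChordSystem`): prescribed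
products `u_e = γ_e + Q_{D_e}`, pin `a_{d_e}` of the second state component for half-chords, reads of the GENUINE privates (`hprivs`), state-free
parts `freeP` (`PstarHalfChordBridgeTools`).  Results, verbatim analogues of the chord bridge:

* `val_of_solution`, `adm_of_solution` — a solution of the forest read as base point + states has model value `(gval₁, gval₂)`; a co-edge holds
  iff its state is admissible (product AND pin);
* `not_infeasible_of_solution` — (T3)-direction: a solution of `J₀ ∧ Γ₁ ∧ Γ₂` refutes infeasibility of the model;
* `chordMinimal_of_solution_erase` — **(M0) ⇒ chord-minimal** for every co-edge, chord or half-chord;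
* `infeasible_of_not_solution` — **(T3) ⇒ infeasible** given the Lift property of the forest (unchanged: `PstarChordBridgeLift`).

So `PstarHalfChordSystem.read_or_dead_of_chordMinimal` (M-read) and `not_reach_of_infeasible` (R2) now speak about terminal cores whose
maximal peelable `F` has half-chord co-edges — the first step of O1 without Assumption A.  Not covered: co-edges with NO private (both AND
variables shared), which `HWF.hp2` excludes; orientation (the private is taken in slot `2`).
-/

set_option linter.dupNamespace false -- `Summit.PneNP.PneNP.…`: summit = sub-problem name (D-0017 single-conjunct layout)

open Finset Literature.Computability.Complexity
open Summit.PneNP.PneNP.Theorems.PstarFibrePolys (bit bit_xor bit_and bit_injective)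
open Summit.PneNP.PneNP.Theorems.PstarPDT (parity bit_eval)
open Summit.PneNP.PneNP.Theorems.PstarTyped (Typed)
open Summit.PneNP.PneNP.Theorems.PstarSALevel (varSet bdry)
open Summit.PneNP.PneNP.Theorems.PstarCentreFree (vars_mem_varSet)
open Summit.PneNP.PneNP.Theorems.PstarGapOneAll (gval)
open Summit.PneNP.PneNP.Theorems.PstarXCore (xpair xverts mem_xpair)
open Summit.PneNP.PneNP.Theorems.PstarNorCoreTools (eq_of_mem_bdry)
open Summit.PneNP.PneNP.Theorems.PstarGapPeeling (eval_congr)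
open Summit.PneNP.PneNP.Theorems.PstarReadSumset (V2)
open Summit.PneNP.PneNP.Theorems.PstarChordSystem (ChordSystem)
open Summit.PneNP.PneNP.Theorems.PstarHalfChordSystem (HalfChordSystem)
open Summit.PneNP.PneNP.Theorems.PstarChordBridgeTools
open Summit.PneNP.PneNP.Theorems.PstarChordBridge (BridgeData Lift toBool bit_toBool)
open Summit.PneNP.PneNP.Theorems.PstarHalfChordBridgeTools

namespace Summit.PneNP.PneNP.Theorems.PstarHalfChordBridge

variable {n m : ℕ}

/-! ## Genuine privates and well-formedness -/

/-- The GENUINE privates of the co-edges `N` inside `J₀`: every slot-`2` variable, and the slot-`3` variables that are private. -/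
def hprivs (I : LocalMap 4 n m) (J₀ N : Finset (Fin m)) : Finset (Fin n) :=
  N.image (fun e => I.vars e 2) ∪ (N.filter fun e => I.vars e 3 ∈ bdry I J₀).image (fun e => I.vars e 3)

/-- Membership in `hprivs`. -/
theorem mem_hprivs (I : LocalMap 4 n m) {J₀ N : Finset (Fin m)} {v : Fin n} :
    v ∈ hprivs I J₀ N ↔ ∃ e ∈ N, I.vars e 2 = v ∨ (I.vars e 3 = v ∧ I.vars e 3 ∈ bdry I J₀) := by
  unfold hprivs
  simp only [mem_union, mem_image, mem_filter]
  constructor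
  · rintro (⟨e, he, h⟩ | ⟨e, ⟨he, hb⟩, h⟩)
    · exact ⟨e, he, Or.inl h⟩
    · exact ⟨e, he, Or.inr ⟨h, hb⟩⟩
  · rintro ⟨e, he, h | ⟨h, hb⟩⟩
    · exact Or.inl ⟨e, he, h⟩
    · exact Or.inr ⟨e, ⟨he, hb⟩, h⟩

/-- **Well-formedness with half-chords**: as `BridgeData.WF` but the co-edges need only a private in slot `2`, and CROSS is measured against
the genuine privates. -/
structure HWF (I : LocalMap 4 n m) (B : BridgeData n m) : Prop where
  /-- co-edges lie in the core -/
  hN : B.N ⊆ B.J₀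
  /-- every co-edge has a private AND variable in slot `2` -/
  hp2 : ∀ e ∈ B.N, I.vars e 2 ∈ bdry I B.J₀
  /-- fundamental sets consist of forest outputs -/
  hD : ∀ e ∈ B.N, B.D e ⊆ B.J₀ \ B.N
  /-- `D e + e` is an even subgraph of the XOR multigraph -/
  hDeven : ∀ e ∈ B.N, ∀ w, Even (xpdeg I (insert e (B.D e)) w)
  /-- joins consist of forest outputs -/
  hT₁ : B.T₁ ⊆ B.J₀ \ B.N
  /-- joins consist of forest outputs -/
  hT₂ : B.T₂ ⊆ B.J₀ \ B.N
  /-- `T₁` joins the XOR reads of the first constraint -/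
  hjoin₁ : ∀ w, Odd (xpdeg I B.T₁ w) ↔ w ∈ B.C₁ ∧ w ∈ xverts I (B.J₀ \ B.N)
  /-- `T₂` joins the XOR reads of the second constraint -/
  hjoin₂ : ∀ w, Odd (xpdeg I B.T₂ w) ↔ w ∈ B.C₂ ∧ w ∈ xverts I (B.J₀ \ B.N)
  /-- no monomial of the first constraint has both variables private -/
  hcross₁ : ∀ g ∈ B.G₁, ¬ (I.vars g 2 ∈ hprivs I B.J₀ B.N ∧ I.vars g 3 ∈ hprivs I B.J₀ B.N)
  /-- no monomial of the second constraint has both variables private -/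
  hcross₂ : ∀ g ∈ B.G₂, ¬ (I.vars g 2 ∈ hprivs I B.J₀ B.N ∧ I.vars g 3 ∈ hprivs I B.J₀ B.N)

section Privs

variable {I : LocalMap 4 n m} {B : BridgeData n m}

/-- A genuine private is a boundary variable of the core. -/
theorem mem_bdry_of_mem_hprivs (hW : HWF I B) {v : Fin n} (hv : v ∈ hprivs I B.J₀ B.N) : v ∈ bdry I B.J₀ := by
  obtain ⟨e, he, h | ⟨h, hb⟩⟩ := (mem_hprivs I).1 hv
  · exact h ▸ hW.hp2 e he
  · exact h ▸ hb

/-- A genuine private of `e ∈ N` is a variable of no OTHER output of the core. -/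
theorem eq_of_vars_eq (hW : HWF I B) {e j : Fin m} (he : e ∈ B.N) (hj : j ∈ B.J₀) {s : Fin 4} {v : Fin n}
    (hv : v ∈ hprivs I B.J₀ B.N) (hve : v ∈ varSet I e) (hvj : I.vars j s = v) : j = e :=
  (eq_of_mem_bdry I (hW.hN he) hj (mem_bdry_of_mem_hprivs hW hv) hve (hvj ▸ vars_mem_varSet I j s)).symm

/-- Forest outputs contain no genuine private. -/
theorem not_mem_hprivs_of_mem_sdiff (hW : HWF I B) {j : Fin m} (hj : j ∈ B.J₀ \ B.N) (s : Fin 4) : I.vars j s ∉ hprivs I B.J₀ B.N := by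
  intro hv
  obtain ⟨e, he, h | ⟨h, -⟩⟩ := (mem_hprivs I).1 hv
  · have := eq_of_vars_eq hW he (mem_sdiff.1 hj).1 hv (h ▸ vars_mem_varSet I e 2) rfl
    exact (mem_sdiff.1 hj).2 (this ▸ he)
  · have := eq_of_vars_eq hW he (mem_sdiff.1 hj).1 hv (h ▸ vars_mem_varSet I e 3) rfl
    exact (mem_sdiff.1 hj).2 (this ▸ he)

/-- Genuine privates are AND-typed, hence not XOR vertices. -/
theorem not_mem_xverts_of_mem_hprivs (hT : Typed I) {v : Fin n} (hv : v ∈ hprivs I B.J₀ B.N) (E : Finset (Fin m)) : v ∉ xverts I E := by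
  obtain ⟨e, -, h | ⟨h, -⟩⟩ := (mem_hprivs I).1 hv
  · exact h ▸ not_mem_xverts_of_two_le I hT E e (s := 2) (by decide)
  · exact h ▸ not_mem_xverts_of_two_le I hT E e (s := 3) (by decide)

/-- **Summing over the genuine privates, co-edge by co-edge.** -/
theorem sum_hprivs (hI : I.IsPure xorAndPred) (hW : HWF I B) (f : Fin n → ZMod 2) :
    ∑ v ∈ hprivs I B.J₀ B.N, f v = ∑ e ∈ B.N, (f (I.vars e 2) + if I.vars e 3 ∈ bdry I B.J₀ then f (I.vars e 3) else 0) := by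
  classical
  have hinj2 : Set.InjOn (fun e => I.vars e 2) ↑B.N := by
    intro e he e' he' h
    exact (eq_of_vars_eq hW he (hW.hN he') ((mem_hprivs I).2 ⟨e, he, Or.inl rfl⟩) (vars_mem_varSet I e 2) h.symm).symm
  have hinj3 : Set.InjOn (fun e => I.vars e 3) ↑(B.N.filter fun e => I.vars e 3 ∈ bdry I B.J₀) := by
    intro e he e' he' h
    have he₀ := (mem_filter.1 (Finset.mem_coe.1 he))
    have he₀' := (mem_filter.1 (Finset.mem_coe.1 he'))
    exact (eq_of_vars_eq hW he₀.1 (hW.hN he₀'.1) ((mem_hprivs I).2 ⟨e, he₀.1, Or.inr ⟨rfl, he₀.2⟩⟩) (vars_mem_varSet I e 3) h.symm).symm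
  have hdisj : Disjoint (B.N.image fun e => I.vars e 2) ((B.N.filter fun e => I.vars e 3 ∈ bdry I B.J₀).image fun e => I.vars e 3) := by
    rw [disjoint_left]
    intro v hv hv'
    obtain ⟨e, he, h2⟩ := mem_image.1 hv
    obtain ⟨e', he', h3⟩ := mem_image.1 hv'
    have hee : e' = e := eq_of_vars_eq hW he (hW.hN (mem_filter.1 he').1) ((mem_hprivs I).2 ⟨e, he, Or.inl h2⟩)
      (h2 ▸ vars_mem_varSet I e 2) h3
    subst hee
    exact absurd (hI.2 e' (h2.trans h3.symm)) (by decide)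
  unfold hprivs
  rw [sum_union hdisj, sum_image hinj2, sum_image hinj3, sum_filter, ← sum_add_distrib]

end Privs

/-! ## The half-chord system of the data -/

/-- **The half-chord system of a terminal core with co-edge set `N`** (chords and half-chords, private in slot `2`). -/
def hsys (I : LocalMap 4 n m) (B : BridgeData n m) : HalfChordSystem (Fin m) (Fin n → ZMod 2) where
  u e x := uval I B.y (B.D e) e x
  ρ e x := if e ∈ B.N then (coef I B.C₁ B.G₁ (I.vars e 2) x, coef I B.C₂ B.G₂ (I.vars e 2) x) else 0
  ρ' e x := if e ∈ B.N ∧ I.vars e 3 ∈ bdry I B.J₀ then (coef I B.C₁ B.G₁ (I.vars e 3) x, coef I B.C₂ B.G₂ (I.vars e 3) x) else 0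
  F x := (freeP I B.y (B.J₀ \ B.N) (hprivs I B.J₀ B.N) B.T₁ B.C₁ B.G₁ x, freeP I B.y (B.J₀ \ B.N) (hprivs I B.J₀ B.N) B.T₂ B.C₂ B.G₂ x)
  t := (bit B.b₁, bit B.b₂)
  Ok _ := True
  pin e x := if I.vars e 3 ∈ bdry I B.J₀ then none else some (x (I.vars e 3))

/-- Unfolding the prescribed product. -/
@[simp] theorem hsys_u (I : LocalMap 4 n m) (B : BridgeData n m) (e : Fin m) (x : Fin n → ZMod 2) :
    (hsys I B).u e x = uval I B.y (B.D e) e x := rfl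

/-- Unfolding the pin. -/
theorem hsys_pin (I : LocalMap 4 n m) (B : BridgeData n m) (e : Fin m) (x : Fin n → ZMod 2) :
    (hsys I B).pin e x = if I.vars e 3 ∈ bdry I B.J₀ then none else some (x (I.vars e 3)) := rfl

/-- **The model's constraint values in closed form** (first coordinate; the second is symmetric). -/
theorem val_hsys (I : LocalMap 4 n m) (B : BridgeData n m) (x : Fin n → ZMod 2) (s : Fin m → ZMod 2 × ZMod 2) :
    (hsys I B).val B.N x s =
      (freeP I B.y (B.J₀ \ B.N) (hprivs I B.J₀ B.N) B.T₁ B.C₁ B.G₁ x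
          + ∑ e ∈ B.N, ((s e).1 * coef I B.C₁ B.G₁ (I.vars e 2) x +
              if I.vars e 3 ∈ bdry I B.J₀ then (s e).2 * coef I B.C₁ B.G₁ (I.vars e 3) x else 0),
        freeP I B.y (B.J₀ \ B.N) (hprivs I B.J₀ B.N) B.T₂ B.C₂ B.G₂ x
          + ∑ e ∈ B.N, ((s e).1 * coef I B.C₂ B.G₂ (I.vars e 2) x +
              if I.vars e 3 ∈ bdry I B.J₀ then (s e).2 * coef I B.C₂ B.G₂ (I.vars e 3) x else 0)) := by
  unfold ChordSystem.val ChordSystem.contrib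
  refine Prod.ext ?_ ?_
  · rw [Prod.fst_add, Prod.fst_sum]
    show freeP I B.y (B.J₀ \ B.N) (hprivs I B.J₀ B.N) B.T₁ B.C₁ B.G₁ x + _ = _
    congr 1
    refine sum_congr rfl fun e he => ?_
    show ((s e).1 • (hsys I B).ρ e x + (s e).2 • (hsys I B).ρ' e x).1 = _
    unfold hsys
    simp only [he, true_and, if_true, Prod.fst_add, Prod.smul_fst, smul_eq_mul]
    split_ifs <;> simp
  · rw [Prod.snd_add, Prod.snd_sum]
    show freeP I B.y (B.J₀ \ B.N) (hprivs I B.J₀ B.N) B.T₂ B.C₂ B.G₂ x + _ = _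
    congr 1
    refine sum_congr rfl fun e he => ?_
    show ((s e).1 • (hsys I B).ρ e x + (s e).2 • (hsys I B).ρ' e x).2 = _
    unfold hsys
    simp only [he, true_and, if_true, Prod.snd_add, Prod.smul_snd, smul_eq_mul]
    split_ifs <;> simp

/-! ## From instance solutions to model states -/

/-- **A solution of the forest outputs, read in the model.** -/
theorem val_of_solution (I : LocalMap 4 n m) (hI : I.IsPure xorAndPred) (hT : Typed I) {B : BridgeData n m} (hW : HWF I B)
    {z : Fin n → Bool} (hz : ∀ j ∈ B.J₀ \ B.N, I.eval z j = B.y j) :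
    (hsys I B).val B.N (fun v => bit (z v)) (fun e => (bit (z (I.vars e 2)), bit (z (I.vars e 3)))) =
      (bit (gval I B.C₁ B.G₁ z), bit (gval I B.C₂ B.G₂ z)) := by
  have hPx : ∀ v ∈ hprivs I B.J₀ B.N, v ∉ xverts I (B.J₀ \ B.N) := fun v hv => not_mem_xverts_of_mem_hprivs hT hv _
  rw [val_hsys, bit_gval_eq_P I hI B.y hW.hT₁ hPx B.C₁ B.G₁ hW.hjoin₁ hW.hcross₁ hz,
    bit_gval_eq_P I hI B.y hW.hT₂ hPx B.C₂ B.G₂ hW.hjoin₂ hW.hcross₂ hz, sum_hprivs hI hW, sum_hprivs hI hW]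

/-- **A co-edge holds iff its state is admissible** (product = prescribed product; the pin of a half-chord holds automatically). -/
theorem adm_of_solution (I : LocalMap 4 n m) (hI : I.IsPure xorAndPred) {B : BridgeData n m} (hW : HWF I B) {z : Fin n → Bool}
    {K : Finset (Fin m)} (hK : K ⊆ B.N) (hzF : ∀ j ∈ B.J₀ \ B.N, I.eval z j = B.y j) (hzK : ∀ e ∈ K, I.eval z e = B.y e) :
    (hsys I B).Adm K (fun v => bit (z v)) (fun e => (bit (z (I.vars e 2)), bit (z (I.vars e 3)))) := by
  intro e he
  have heN := hK he
  have heD : e ∉ B.D e := fun h => (mem_sdiff.1 (hW.hD e heN h)).2 heN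
  refine ⟨(eval_eq_iff_chord I hI B.y (hW.hD e heN) heD (hW.hDeven e heN) hzF).1 (hzK e he), fun v hv => ?_⟩
  rw [hsys_pin] at hv
  split_ifs at hv with h
  cases hv; rfl

/-- **A solution of the whole terminal system refutes infeasibility of the model.** -/
theorem not_infeasible_of_solution (I : LocalMap 4 n m) (hI : I.IsPure xorAndPred) (hT : Typed I) {B : BridgeData n m} (hW : HWF I B)
    {z : Fin n → Bool} (hz : PstarChordBridge.Solution I B B.J₀ z) : ¬ (hsys I B).Infeasible B.N := by
  intro hinf
  have hz' : ∀ j ∈ B.J₀ \ B.N, I.eval z j = B.y j := fun j hj => hz.1 j (mem_sdiff.1 hj).1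
  refine hinf (fun v => bit (z v)) trivial _ (adm_of_solution I hI hW (Subset.refl _) hz' fun e he => hz.1 e (hW.hN he)) ?_
  rw [val_of_solution I hI hT hW hz', hz.2.1, hz.2.2]
  rfl

/-- **(M0) ⇒ chord-minimal**, for chords and half-chords alike. -/
theorem chordMinimal_of_solution_erase (I : LocalMap 4 n m) (hI : I.IsPure xorAndPred) (hT : Typed I) {B : BridgeData n m} (hW : HWF I B)
    {e : Fin m} (he : e ∈ B.N) {z : Fin n → Bool} (hz : PstarChordBridge.Solution I B (B.J₀.erase e) z) :
    (hsys I B).ChordMinimal B.N e := by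
  have hz' : ∀ j ∈ B.J₀ \ B.N, I.eval z j = B.y j := fun j hj =>
    hz.1 j (mem_erase.2 ⟨fun h => (mem_sdiff.1 hj).2 (h ▸ he), (mem_sdiff.1 hj).1⟩)
  refine ⟨fun v => bit (z v), trivial, fun e => (bit (z (I.vars e 2)), bit (z (I.vars e 3))), ?_, ?_⟩
  · exact adm_of_solution I hI hW (erase_subset _ _) hz' fun e' he' =>
      hz.1 e' (mem_erase.2 ⟨ne_of_mem_erase he', hW.hN (mem_of_mem_erase he')⟩)
  · rw [val_of_solution I hI hT hW hz', hz.2.1, hz.2.2]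
    rfl

/-! ## From model states to instance solutions -/

/-- Overwrite the genuine privates by the Boolean states. -/
noncomputable def setP (I : LocalMap 4 n m) (J₀ N : Finset (Fin m)) (s : Fin m → Bool × Bool) (z : Fin n → Bool) : Fin n → Bool :=
  fun v => if h : ∃ e ∈ N, I.vars e 2 = v then (s h.choose).1
    else if h' : ∃ e ∈ N, I.vars e 3 = v ∧ I.vars e 3 ∈ bdry I J₀ then (s h'.choose).2 else z v

section SetP

variable {I : LocalMap 4 n m} {B : BridgeData n m}

/-- Outside the genuine privates nothing changes. -/
theorem setP_of_not_mem (s : Fin m → Bool × Bool) (z : Fin n → Bool) {v : Fin n} (hv : v ∉ hprivs I B.J₀ B.N) :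
    setP I B.J₀ B.N s z v = z v := by
  unfold setP
  rw [mem_hprivs] at hv
  have h1 : ¬ ∃ e ∈ B.N, I.vars e 2 = v := fun ⟨e, he, h⟩ => hv ⟨e, he, Or.inl h⟩
  have h2 : ¬ ∃ e ∈ B.N, I.vars e 3 = v ∧ I.vars e 3 ∈ bdry I B.J₀ := fun ⟨e, he, h, hb⟩ => hv ⟨e, he, Or.inr ⟨h, hb⟩⟩
  rw [dif_neg h1, dif_neg h2]

/-- The slot-`2` private of a co-edge receives the first state bit. -/
theorem setP_two (hW : HWF I B) (s : Fin m → Bool × Bool) (z : Fin n → Bool) {e : Fin m} (he : e ∈ B.N) :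
    setP I B.J₀ B.N s z (I.vars e 2) = (s e).1 := by
  unfold setP
  have h : ∃ e' ∈ B.N, I.vars e' 2 = I.vars e 2 := ⟨e, he, rfl⟩
  rw [dif_pos h]
  have := eq_of_vars_eq hW he (hW.hN h.choose_spec.1) ((mem_hprivs I).2 ⟨e, he, Or.inl rfl⟩) (vars_mem_varSet I e 2)
    h.choose_spec.2
  rw [this]

/-- A private slot-`3` variable receives the second state bit. -/
theorem setP_three (hI : I.IsPure xorAndPred) (hW : HWF I B) (s : Fin m → Bool × Bool) (z : Fin n → Bool) {e : Fin m} (he : e ∈ B.N)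
    (hb : I.vars e 3 ∈ bdry I B.J₀) : setP I B.J₀ B.N s z (I.vars e 3) = (s e).2 := by
  unfold setP
  have h1 : ¬ ∃ e' ∈ B.N, I.vars e' 2 = I.vars e 3 := by
    rintro ⟨e', he', h⟩
    have := eq_of_vars_eq hW he (hW.hN he') ((mem_hprivs I).2 ⟨e, he, Or.inr ⟨rfl, hb⟩⟩) (vars_mem_varSet I e 3) h
    subst this
    exact absurd (hI.2 _ h) (by decide)
  have h : ∃ e' ∈ B.N, I.vars e' 3 = I.vars e 3 ∧ I.vars e' 3 ∈ bdry I B.J₀ := ⟨e, he, rfl, hb⟩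
  rw [dif_neg h1, dif_pos h]
  have := eq_of_vars_eq hW he (hW.hN h.choose_spec.1) ((mem_hprivs I).2 ⟨e, he, Or.inr ⟨rfl, hb⟩⟩) (vars_mem_varSet I e 3)
    h.choose_spec.2.1
  rw [this]

/-- Overwriting genuine privates does not disturb the forest outputs. -/
theorem eval_setP_of_mem_sdiff (hW : HWF I B) (s : Fin m → Bool × Bool) (z : Fin n → Bool) {j : Fin m} (hj : j ∈ B.J₀ \ B.N) :
    I.eval (setP I B.J₀ B.N s z) j = I.eval z j :=
  eval_congr I j fun t => setP_of_not_mem s z (not_mem_hprivs_of_mem_sdiff hW hj t)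

end SetP

/-- **(T3) ⇒ infeasible.**  If the forest lifts and `J₀ ∧ Γ₁ ∧ Γ₂` has no solution, the half-chord model is infeasible. -/
theorem infeasible_of_not_solution (I : LocalMap 4 n m) (hI : I.IsPure xorAndPred) (hT : Typed I) {B : BridgeData n m} (hW : HWF I B)
    (hL : Lift I B) (hno : ¬ ∃ z, PstarChordBridge.Solution I B B.J₀ z) : (hsys I B).Infeasible B.N := by
  intro x₀ _ s hadm hval
  apply hno
  obtain ⟨z₁, hz₁, hz₁x⟩ := hL fun v => toBool (x₀ v)
  let sB : Fin m → Bool × Bool := fun e => (toBool (s e).1, toBool (s e).2)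
  let z : Fin n → Bool := setP I B.J₀ B.N sB z₁
  have hzF : ∀ j ∈ B.J₀ \ B.N, I.eval z j = B.y j := fun j hj => by
    rw [eval_setP_of_mem_sdiff hW sB z₁ hj]; exact hz₁ j hj
  -- the new base point agrees with `x₀` off the XOR vertices and the genuine privates
  have hagree : ∀ v, v ∉ xverts I (B.J₀ \ B.N) → v ∉ hprivs I B.J₀ B.N → x₀ v = bit (z v) := by
    intro v hvx hvp
    show x₀ v = bit (setP I B.J₀ B.N sB z₁ v)
    rw [setP_of_not_mem sB z₁ hvp, hz₁x v hvx, bit_toBool]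
  have hs2 : ∀ e ∈ B.N, bit (z (I.vars e 2)) = (s e).1 := fun e he => by
    show bit (setP I B.J₀ B.N sB z₁ (I.vars e 2)) = _
    rw [setP_two hW sB z₁ he]; exact bit_toBool _
  -- the second component: a private slot-3 variable receives the state bit; a pinned one already carries it
  have hs3 : ∀ e ∈ B.N, bit (z (I.vars e 3)) = (s e).2 := by
    intro e he
    by_cases hb : I.vars e 3 ∈ bdry I B.J₀
    · show bit (setP I B.J₀ B.N sB z₁ (I.vars e 3)) = _
      rw [setP_three hI hW sB z₁ he hb]; exact bit_toBool _
    · have hpin := (hadm e he).2 (x₀ (I.vars e 3)) (by rw [hsys_pin, if_neg hb])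
      have hv : I.vars e 3 ∉ hprivs I B.J₀ B.N := fun h => hb (mem_bdry_of_mem_hprivs hW h)
      rw [← hagree _ (not_mem_xverts_of_two_le I hT _ e (s := 3) (by decide)) hv, hpin]
  -- the model data at the new base point equal those at `x₀`
  have hPF : ∀ j ∈ B.J₀ \ B.N, I.vars j 2 ∉ hprivs I B.J₀ B.N ∧ I.vars j 3 ∉ hprivs I B.J₀ B.N := fun j hj =>
    ⟨not_mem_hprivs_of_mem_sdiff hW hj 2, not_mem_hprivs_of_mem_sdiff hW hj 3⟩
  have huval : ∀ e ∈ B.N, uval I B.y (B.D e) e (fun v => bit (z v)) = uval I B.y (B.D e) e x₀ := by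
    intro e he
    unfold uval
    congr 1
    refine sum_congr rfl fun j hj => ?_
    rw [hagree _ (not_mem_xverts_of_two_le I hT _ j (s := 2) (by decide)) (hPF j (hW.hD e he hj)).1,
      hagree _ (not_mem_xverts_of_two_le I hT _ j (s := 3) (by decide)) (hPF j (hW.hD e he hj)).2]
  have hcoef : ∀ (C : Finset (Fin n)) (G : Finset (Fin m)),
      (∀ g ∈ G, ¬ (I.vars g 2 ∈ hprivs I B.J₀ B.N ∧ I.vars g 3 ∈ hprivs I B.J₀ B.N)) →
      ∀ p ∈ hprivs I B.J₀ B.N, coef I C G p (fun v => bit (z v)) = coef I C G p x₀ := by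
    intro C G hcross p hp
    unfold coef
    congr 1
    refine sum_congr rfl fun g hg => ?_
    congr 1
    · by_cases h2 : I.vars g 2 = p
      · rw [if_pos h2, if_pos h2, hagree _ (not_mem_xverts_of_two_le I hT _ g (s := 3) (by decide))
          fun h3 => hcross g hg ⟨h2 ▸ hp, h3⟩]
      · rw [if_neg h2, if_neg h2]
    · by_cases h3 : I.vars g 3 = p
      · rw [if_pos h3, if_pos h3, hagree _ (not_mem_xverts_of_two_le I hT _ g (s := 2) (by decide))
          fun h2 => hcross g hg ⟨h2, h3 ▸ hp⟩]
      · rw [if_neg h3, if_neg h3]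
  have hval' : (hsys I B).val B.N (fun v => bit (z v)) (fun e => (bit (z (I.vars e 2)), bit (z (I.vars e 3)))) =
      (hsys I B).val B.N x₀ s := by
    rw [val_hsys, val_hsys,
      freeP_congr I hT B.y hW.hT₁ _ hPF B.C₁ B.G₁ (fun v h1 h2 => (hagree v h1 h2)),
      freeP_congr I hT B.y hW.hT₂ _ hPF B.C₂ B.G₂ (fun v h1 h2 => (hagree v h1 h2))]
    refine Prod.ext ?_ ?_
    · simp only
      congr 1
      refine sum_congr rfl fun e he => ?_
      rw [hs2 e he, hs3 e he, hcoef B.C₁ B.G₁ hW.hcross₁ _ ((mem_hprivs I).2 ⟨e, he, Or.inl rfl⟩)]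
      split_ifs with hb
      · rw [hcoef B.C₁ B.G₁ hW.hcross₁ _ ((mem_hprivs I).2 ⟨e, he, Or.inr ⟨rfl, hb⟩⟩)]
      · rfl
    · simp only
      congr 1
      refine sum_congr rfl fun e he => ?_
      rw [hs2 e he, hs3 e he, hcoef B.C₂ B.G₂ hW.hcross₂ _ ((mem_hprivs I).2 ⟨e, he, Or.inl rfl⟩)]
      split_ifs with hb
      · rw [hcoef B.C₂ B.G₂ hW.hcross₂ _ ((mem_hprivs I).2 ⟨e, he, Or.inr ⟨rfl, hb⟩⟩)]
      · rfl
  refine ⟨z, fun j hj => ?_, ?_, ?_⟩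
  · by_cases hjN : j ∈ B.N
    · have heD : j ∉ B.D j := fun h => (mem_sdiff.1 (hW.hD j hjN h)).2 hjN
      rw [eval_eq_iff_chord I hI B.y (hW.hD j hjN) heD (hW.hDeven j hjN) hzF, hs2 j hjN, hs3 j hjN, (hadm j hjN).1, hsys_u]
      exact (huval j hjN).symm
    · exact hzF j (mem_sdiff.2 ⟨hj, hjN⟩)
  · apply bit_injective
    have := congrArg Prod.fst (val_of_solution I hI hT hW hzF)
    rw [hval', hval] at this
    exact this.symm
  · apply bit_injective
    have := congrArg Prod.snd (val_of_solution I hI hT hW hzF)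
    rw [hval', hval] at this
    exact this.symm

/-- **Summary: the half-chord model is infeasible iff the terminal system is unsolvable** (given the lift property of the forest). -/
theorem infeasible_iff (I : LocalMap 4 n m) (hI : I.IsPure xorAndPred) (hT : Typed I) {B : BridgeData n m} (hW : HWF I B)
    (hL : Lift I B) : (hsys I B).Infeasible B.N ↔ ¬ ∃ z, PstarChordBridge.Solution I B B.J₀ z :=
  ⟨fun h ⟨_, hz⟩ => not_infeasible_of_solution I hI hT hW hz h, infeasible_of_not_solution I hI hT hW hL⟩

end Summit.PneNP.PneNP.Theorems.PstarHalfChordBridge
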